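import Mathlib
import Summits.ResolutionOfSingularities.ResolutionOfSingularities.Theorems.WeightedInvariantLocalWeightedDropNCResRegimeLetterReading
import Summits.ResolutionOfSingularities.ResolutionOfSingularities.Theorems.WeightedInvariantLocalWeightedDropNCResRegimePresentedAssembly

/-!
# `LocalWeightedDrop`, TOT2-LINE inner S-ASM (7): REGIME (L) ASSEMBLED FROM THE PIECES OF REGIME (P) — fold the letter into the history, play
# the presented game, read every exit on the unfolded decoration; and the v2 → v1 bridge for regime (P)

Crux item stmt-ResolutionOfSingularities-8899 `WeightedInvariant.LocalWeightedDrop` (route `ResolutionOfSingularities/WeightedInvariant`), ENGINE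
skeleton v33 (35b29332b4d99231), registered stubs **`stub_regimeLetter`** (L) and `stub_regimePresented` (P); TOT2-LINE v1.3 §3 (L) + STATUS 17:2xZ
«(P2) ONE-STEP TARGET SHAPE v2 + (L) BECOMES HAND-FREE» (res-L1-w43-lead-1 g5).  [OURS · L1 W4.3 · chain w43 · seat res-L1-w43-lead-1 gen 5;
def-free; the PIECES are hypotheses in their v2 shape (at the same head the step ALWAYS hands over the presented successor; the only
non-presented exit is an order drop): (P1) entry / (Px) exit reading / (P2′)/(P2c′) steps = res-L1-w43-stub-2, budget `M` with `hM_succ`/`hM_conf`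
= res-type-088's successor, selector ρ-T = stub-2's `wellFounded_polyRelSel`; the unfold reader = part (6) (`hCol_or_goodDir_or_badDir_unfold`).
Nothing here is a statement of any manuscript; AI-produced, gate-checked, weaker than expert review.]

* **`regimeLetter_of_pieces`** — from `LetterDir δ l`: fold `δ⁺ := (f, E, {l})` (admissible for the same germ, history `{l}`, outside the apex column),
  run the presented play of regime (P) on `δ⁺`-decorations with measure `Λ·M + rank`, and read every state `ε` on `U ε := (ε.f, ε.E, ∅)` (when the
  order has not dropped; `ε` itself otherwise): an order drop is a head drop for `U`; a same-head successor outside the label regime is in the apex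
  column for the FOLDED decoration (Px), hence `HCol ∨ GoodDir ∨ BadDir` for the unfold (part (6)) — the registered (L)-exit;
* `stub_regimeLetter_of_pieces` — under the stub's binders;
* `regimePresented_of_pieces₂`, `stub_regimePresented_of_pieces₂` — the v2 step shapes imply the v1 shapes of part (5) (regime (P)).
-/

set_option linter.dupNamespace false -- mandated namespace of this single-conjunct summit

noncomputable section

namespace Summit.ResolutionOfSingularities.ResolutionOfSingularities.Theorems

namespace TameFourTupleDrop

open MvPowerSeries Literature.AlgebraicGeometry.Resolution PolyDescent

variable {k : Type} [Field k]

omit [Field k] in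
/-- Two decorations with the same equation, boundary and history are equal. -/
theorem Decoration.eq_of_parts {m : ℕ} {ε ε' : Decoration k m} (hf : ε.f = ε'.f) (hE : ε.E = ε'.E) (hO : ε.O = ε'.O) : ε = ε' := by
  cases ε; cases ε'
  simp only at hf hE hO
  subst hf; subst hE; subst hO
  rfl

/-- **REGIME (L) FROM THE PIECES OF REGIME (P)** (three letters, a field with infinitely many elements; v2 step shapes). -/
theorem regimeLetter_of_pieces [Infinite k]
    (ψsel : (d : ℕ) → (Fin d → MvPowerSeries (Fin 2) k) → MvPowerSeries (Fin 2) k)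
    (hsel : ∀ (d : ℕ) (X : Fin d → MvPowerSeries (Fin 2) k), IsPosT d X → IsPrepRecentring d X (ψsel d X))
    (M : (d : ℕ) → (Fin d → MvPowerSeries (Fin 2) k) → Finset (Fin 2) → ℕ)
    (hM_succ : ∀ (d : ℕ) (A : Fin d → MvPowerSeries (Fin 2) k) (N : Finset (Fin 2)) (A' : Fin d → MvPowerSeries (Fin 2) k)
      (N' : Finset (Fin 2)),
      (∃ (b : MvPowerSeries (Fin (2 + 1)) k) (δ : Decoration k 2) (Θ : Fin (2 + 1) → MvPowerSeries (Fin (2 + 1)) k),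
        Admissible b δ ∧ 2 ≤ δ.o ∧ δ.c = d ∧ δ.PresBy d A N Θ) →
      InPoly d A → InPoly d A' → SuccFamilySel d (ψsel d) A N A' N' → M d A' N' ≤ M d A N)
    (hM_conf : ∀ (d : ℕ) (A : Fin d → MvPowerSeries (Fin 2) k) (N : Finset (Fin 2)) (A' : Fin d → MvPowerSeries (Fin 2) k)
      (N' : Finset (Fin 2)),
      (∃ (b : MvPowerSeries (Fin (2 + 1)) k) (δ : Decoration k 2) (Θ : Fin (2 + 1) → MvPowerSeries (Fin (2 + 1)) k),
        Admissible b δ ∧ 2 ≤ δ.o ∧ δ.c = d ∧ δ.PresBy d A N Θ) →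
      InPoly d A → InPoly d A' → NCPoly.Conflict d A N → PointFamilySel d (ψsel d) A N A' N' → M d A' N' < M d A N)
    (hP1 : ∀ (b : MvPowerSeries (Fin (2 + 1)) k) (δ : Decoration k 2), Admissible b δ → 2 ≤ δ.o → ¬ δ.HCol →
      (δ.O.Nonempty ∨ δ.GoodDir) →
      ∃ (A : Fin δ.c → MvPowerSeries (Fin 2) k) (N : Finset (Fin 2)) (Θ : Fin (2 + 1) → MvPowerSeries (Fin (2 + 1)) k),
        δ.PresBy δ.c A N Θ ∧ InPoly δ.c A)
    (hPx : ∀ (b : MvPowerSeries (Fin (2 + 1)) k) (δ : Decoration k 2) (d : ℕ) (A : Fin d → MvPowerSeries (Fin 2) k) (N : Finset (Fin 2))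
      (Θ : Fin (2 + 1) → MvPowerSeries (Fin (2 + 1)) k),
      Admissible b δ → 2 ≤ δ.o → δ.c = d → δ.PresBy d A N Θ → WellPrepared d A → ¬ InPoly d A → δ.HCol)
    (hP2' : ∀ (b : MvPowerSeries (Fin (2 + 1)) k) (δ : Decoration k 2) (d : ℕ) (A : Fin d → MvPowerSeries (Fin 2) k) (N : Finset (Fin 2))
      (Θ : Fin (2 + 1) → MvPowerSeries (Fin (2 + 1)) k),
      Admissible b δ → 2 ≤ δ.o → δ.c = d → δ.PresBy d A N Θ → InPoly d A → ¬ NCPoly.Conflict d A N →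
      ∃ (Φ : Fin (2 + 1) → MvPowerSeries (Fin (2 + 1)) k) (w : Fin (2 + 1) → ℕ), IsCountMove Φ w ∧
        MoveClause b Φ w (fun b' => ∃ δ' : Decoration k 2, Admissible b' δ' ∧ (δ'.o < δ.o ∨ (δ'.head = δ.head ∧
          ∃ (A' : Fin d → MvPowerSeries (Fin 2) k) (N' : Finset (Fin 2)) (Θ' : Fin (2 + 1) → MvPowerSeries (Fin (2 + 1)) k),
            δ'.PresBy d A' N' Θ' ∧ WellPrepared d A' ∧ SuccFamilySel d (ψsel d) A N A' N'))))
    (hP2c' : ∀ (b : MvPowerSeries (Fin (2 + 1)) k) (δ : Decoration k 2) (d : ℕ) (A : Fin d → MvPowerSeries (Fin 2) k) (N : Finset (Fin 2))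
      (Θ : Fin (2 + 1) → MvPowerSeries (Fin (2 + 1)) k),
      Admissible b δ → 2 ≤ δ.o → δ.c = d → δ.PresBy d A N Θ → InPoly d A → NCPoly.Conflict d A N →
      ∃ (Φ : Fin (2 + 1) → MvPowerSeries (Fin (2 + 1)) k) (w : Fin (2 + 1) → ℕ), IsCountMove Φ w ∧
        MoveClause b Φ w (fun b' => ∃ δ' : Decoration k 2, Admissible b' δ' ∧ (δ'.o < δ.o ∨ (δ'.head = δ.head ∧
          ∃ (A' : Fin d → MvPowerSeries (Fin 2) k) (N' : Finset (Fin 2)) (Θ' : Fin (2 + 1) → MvPowerSeries (Fin (2 + 1)) k),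
            δ'.PresBy d A' N' Θ' ∧ WellPrepared d A' ∧ PointFamilySel d (ψsel d) A N A' N'))))
    (b : MvPowerSeries (Fin (2 + 1)) k) (δ : Decoration k 2) (hadm : Admissible b δ) (ho : 2 ≤ δ.o) {l : Fin (2 + 1)} (hl : δ.LetterDir l) :
    DWinsTo (St := MvPowerSeries (Fin (2 + 1)) k × Decoration k 2) Prod.fst
      (fun τ => Admissible τ.1 τ.2 ∧ (τ.2.head < δ.head ∨ (τ.2.head = δ.head ∧ (τ.2.HCol ∨ τ.2.GoodDir ∨ τ.2.BadDir)))) (b, δ) := by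
  classical
  obtain ⟨hO, hlE, hdir⟩ := hl
  -- THE FOLD `δ⁺ = (f, E, {l})`
  let δp : Decoration k 2 := ⟨δ.f, δ.E, {l}, Finset.singleton_subset_iff.mpr hlE⟩
  have hδpo : δp.o = δ.o := rfl
  have hδpc : δp.c = δ.o + 1 := by
    have h1 : δp.c = δp.o + δp.O.card := rfl
    have h2 : δp.O.card = 1 := Finset.card_singleton l
    rw [h1, h2, hδpo]
  have hδc : δ.c = δ.o := Decoration.c_eq_o_of_O_eq_empty hO
  have hadmp : Admissible b δp := hadm
  -- `δ⁺` is outside the apex column: `in_{o+1}(f · x_l) = λ · v_l^{o+1}`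
  have hdirp : δp.IsDirForm (Pi.single l 1) := by
    obtain ⟨hℓ0, la, hla, hcone⟩ := hdir
    rw [hδc, hO, Finset.prod_empty, mul_one] at hcone
    refine ⟨hℓ0, la, hla, fun v => ?_⟩
    show CobordantChart.initEval (fun _ : Fin (2 + 1) => 1) v δp.c (δ.f * ∏ l' ∈ ({l} : Finset (Fin (2 + 1))), X l') = _
    rw [hδpc, Finset.prod_singleton, TOT2Near.initEval_mul_X, hcone, single_one_dotProduct, pow_succ, mul_assoc]
  have hncp : ¬ δp.HCol := Decoration.not_hCol_of_isDirForm hdirp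
  have hnep : δp.O.Nonempty := ⟨l, Finset.mem_singleton_self l⟩
  -- the degree of the folded phase and the entry presentation
  set d : ℕ := δp.c with hd_def
  have hd : 0 < d := by omega
  obtain ⟨A₀, N₀, Θ₀, hpres₀, hin₀⟩ := hP1 b δp hadmp (hδpo ▸ ho) hncp (Or.inl hnep)
  -- THE UNFOLD `U ε = (ε.f, ε.E, ∅)` at the order of the phase, `ε` itself once the order dropped
  let U : Decoration k 2 → Decoration k 2 := fun ε =>
    if ε.o = δ.o then ⟨ε.f, ε.E, ∅, Finset.empty_subset _⟩ else ε
  have hUeq : ∀ ε : Decoration k 2, ε.o = δ.o → (U ε).f = ε.f ∧ (U ε).E = ε.E ∧ (U ε).O = ∅ := fun ε h => by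
    refine ⟨?_, ?_, ?_⟩ <;> simp only [U, if_pos h]
  have hUlt : ∀ ε : Decoration k 2, ε.o ≠ δ.o → U ε = ε := fun ε h => by simp only [U, if_neg h]
  have hUadm : ∀ (b' : MvPowerSeries (Fin (2 + 1)) k) (ε : Decoration k 2), Admissible b' ε → Admissible b' (U ε) := by
    intro b' ε hε
    by_cases h : ε.o = δ.o
    · obtain ⟨hf, hE, -⟩ := hUeq ε h
      obtain ⟨h1, h2, h3⟩ := hε
      refine ⟨?_, ?_, ?_⟩
      · simpa [Decoration.total, hf, hE] using h1
      · rw [hf]; exact h2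
      · rw [hf, hE]; exact h3
    · rw [hUlt ε h]; exact hε
  have hU0 : U δp = δ := by
    obtain ⟨hf, hE, hO'⟩ := hUeq δp hδpo
    exact Decoration.eq_of_parts hf hE (hO'.trans hO.symm)
  -- rich states, target read through `U`, region, measure
  let St : Type := (MvPowerSeries (Fin (2 + 1)) k × Decoration k 2) × ((Fin d → MvPowerSeries (Fin 2) k) × Finset (Fin 2))
  let germ : St → MvPowerSeries (Fin (2 + 1)) k := fun σ => σ.1.1
  let Q : St → Prop := fun σ => Admissible σ.1.1 (U σ.1.2) ∧
    ((U σ.1.2).head < δ.head ∨ ((U σ.1.2).head = δ.head ∧ ((U σ.1.2).HCol ∨ (U σ.1.2).GoodDir ∨ (U σ.1.2).BadDir)))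
  let C : Set St := {σ | Admissible σ.1.1 σ.1.2 ∧ σ.1.2.head = δp.head ∧
    (∃ Θ : Fin (2 + 1) → MvPowerSeries (Fin (2 + 1)) k, σ.1.2.PresBy d σ.2.1 σ.2.2 Θ) ∧ InPoly d σ.2.1}
  let rk : (Fin d → MvPowerSeries (Fin 2) k) → Ordinal.{0} := fun A => ((wellFounded_polyRelSel (k := k) hd (hsel d)).apply A).rank
  let Λ : Ordinal.{0} := (⨆ A, rk A) + 1
  have hΛ : ∀ A, rk A < Λ := fun A => Order.lt_add_one_iff.mpr (le_ciSup (Ordinal.bddAbove_of_small (s := Set.range rk)) A)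
  let μ : St → Ordinal.{0} := fun σ => Λ * (M d σ.2.1 σ.2.2 : Ordinal.{0}) + rk σ.2.1
  have hlex : ∀ (m m' : ℕ) (A A' : Fin d → MvPowerSeries (Fin 2) k), m' < m ∨ (m' = m ∧ rk A' < rk A) →
      Λ * (m' : Ordinal.{0}) + rk A' < Λ * (m : Ordinal.{0}) + rk A := by
    rintro m m' A A' (hm | ⟨rfl, hr⟩)
    · have hm' : ((m' + 1 : ℕ) : Ordinal.{0}) ≤ (m : Ordinal.{0}) := Nat.cast_le.mpr (Nat.succ_le_of_lt hm)
      calc Λ * (m' : Ordinal.{0}) + rk A' < Λ * (m' : Ordinal.{0}) + Λ := by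
            gcongr
            exact hΛ A'
        _ = Λ * ((m' + 1 : ℕ) : Ordinal.{0}) := by rw [Nat.cast_succ, mul_add_one]
        _ ≤ Λ * (m : Ordinal.{0}) := by gcongr
        _ ≤ Λ * (m : Ordinal.{0}) + rk A := le_self_add
    · gcongr
  -- head bookkeeping in the folded phase
  have hoc : ∀ ε : Decoration k 2, ε.head = δp.head → ε.o = δ.o ∧ ε.c = d := by
    intro ε h
    rw [Decoration.head, Decoration.head, toLex_inj, Prod.ext_iff] at h
    exact ⟨h.1.trans hδpo, h.2⟩
  have hOone : ∀ ε : Decoration k 2, ε.head = δp.head → ∃ l', ε.O = {l'} := by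
    intro ε h
    obtain ⟨hoε, hcε⟩ := hoc ε h
    have hcard : ε.O.card = 1 := by
      have h1 : ε.c = ε.o + ε.O.card := rfl
      omega
    exact Finset.card_eq_one.mp hcard
  -- the exit for the unfold at an order drop
  have hQ_of_lt : ∀ (b' : MvPowerSeries (Fin (2 + 1)) k) (ε : Decoration k 2), Admissible b' ε → ε.o < δ.o → Q ((b', ε), (A₀, N₀)) := by
    intro b' ε hε hlt
    refine ⟨hUadm b' ε hε, Or.inl ?_⟩
    show (U ε).head < δ.head
    rw [hUlt ε hlt.ne, Decoration.head, Decoration.head, Prod.Lex.toLex_lt_toLex]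
    exact Or.inl hlt
  -- the exit for the unfold at a same-head successor outside the label regime
  have hQ_of_exit : ∀ (b' : MvPowerSeries (Fin (2 + 1)) k) (ε : Decoration k 2), Admissible b' ε → ε.head = δp.head →
      ∀ (A' : Fin d → MvPowerSeries (Fin 2) k) (N' : Finset (Fin 2)) (Θ' : Fin (2 + 1) → MvPowerSeries (Fin (2 + 1)) k),
      ε.PresBy d A' N' Θ' → WellPrepared d A' → ¬ InPoly d A' → Q ((b', ε), (A', N')) := by
    intro b' ε hε hhead A' N' Θ' hpres hWP hnin
    obtain ⟨hoε, hcε⟩ := hoc ε hhead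
    have hoε2 : 2 ≤ ε.o := by rw [hoε]; exact ho
    have hcolε : ε.HCol := hPx b' ε d A' N' Θ' hε hoε2 hcε hpres hWP hnin
    obtain ⟨l', hOl'⟩ := hOone ε hhead
    obtain ⟨hf, hE, hO'⟩ := hUeq ε hoε
    have hUo : (U ε).o = δ.o := by rw [Decoration.o, hf, show (ε.f.order).toNat = ε.o from rfl, hoε]
    have hUc : (U ε).c = δ.o := by rw [Decoration.c, hO', Finset.card_empty, add_zero, hUo]
    refine ⟨hUadm b' ε hε, Or.inr ⟨?_, ?_⟩⟩
    · rw [Decoration.head, Decoration.head, hUo, hUc, hδc]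
    · exact Decoration.hCol_or_goodDir_or_badDir_unfold hε hoε2 hOl' hcε hpres hcolε hf hE hO'
  have hσ₀ : (((b, δp), (A₀, N₀)) : St) ∈ C := ⟨hadmp, rfl, ⟨Θ₀, hpres₀⟩, hin₀⟩
  have hwin : DWinsTo germ Q (((b, δp), (A₀, N₀)) : St) := by
    refine DWinsTo.of_measure C μ ?_ hσ₀
    rintro ⟨⟨b₁, ε₁⟩, ⟨A₁, N₁⟩⟩ ⟨hadm₁, hhead₁, ⟨Θ₁, hpres₁⟩, hin₁⟩ -
    obtain ⟨ho₁, hc₁⟩ := hoc ε₁ hhead₁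
    have ho₁' : 2 ≤ ε₁.o := by rw [ho₁]; exact ho
    have hctx : ∃ (b : MvPowerSeries (Fin (2 + 1)) k) (δ : Decoration k 2) (Θ : Fin (2 + 1) → MvPowerSeries (Fin (2 + 1)) k),
        Admissible b δ ∧ 2 ≤ δ.o ∧ δ.c = d ∧ δ.PresBy d A₁ N₁ Θ := ⟨b₁, ε₁, Θ₁, hadm₁, ho₁', hc₁, hpres₁⟩
    -- a presented successor: continue (regime label, smaller measure) or exit through the unfold reader
    have hread : ∀ (b' : MvPowerSeries (Fin (2 + 1)) k) (ε' : Decoration k 2), Admissible b' ε' → ε'.head = δp.head →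
        ∀ (A' : Fin d → MvPowerSeries (Fin 2) k) (N' : Finset (Fin 2)) (Θ' : Fin (2 + 1) → MvPowerSeries (Fin (2 + 1)) k),
        ε'.PresBy d A' N' Θ' → WellPrepared d A' →
        (M d A' N' < M d A₁ N₁ ∨ (M d A' N' = M d A₁ N₁ ∧ rk A' < rk A₁) ∨ ¬ InPoly d A') →
        ∃ τ' : St, germ τ' = b' ∧ (Q τ' ∨ (τ' ∈ C ∧ μ τ' < μ ((b₁, ε₁), (A₁, N₁)))) := by
      intro b' ε' hadm' hhead' A' N' Θ' hpres' hWP' halt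
      by_cases hin' : InPoly d A'
      · rcases halt with hlt | hlt | hnin
        · exact ⟨((b', ε'), (A', N')), rfl, Or.inr ⟨⟨hadm', hhead', ⟨Θ', hpres'⟩, hin'⟩, hlex _ _ _ _ (Or.inl hlt)⟩⟩
        · exact ⟨((b', ε'), (A', N')), rfl, Or.inr ⟨⟨hadm', hhead', ⟨Θ', hpres'⟩, hin'⟩, hlex _ _ _ _ (Or.inr hlt)⟩⟩
        · exact absurd hin' hnin
      · exact ⟨((b', ε'), (A', N')), rfl, Or.inl (hQ_of_exit b' ε' hadm' hhead' A' N' Θ' hpres' hWP' hin')⟩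
    by_cases hconf : NCPoly.Conflict d A₁ N₁
    · obtain ⟨Φ, w, hmv, hcl⟩ := hP2c' b₁ ε₁ d A₁ N₁ Θ₁ hadm₁ ho₁' hc₁ hpres₁ hin₁ hconf
      refine ⟨Φ, w, hmv, hcl.mono fun b' hb' => ?_⟩
      obtain ⟨ε', hadm', hcase⟩ := hb'
      rcases hcase with hlt | ⟨hhead', A', N', Θ', hpres', hWP', hfam⟩
      · exact ⟨((b', ε'), (A₀, N₀)), rfl, Or.inl (hQ_of_lt b' ε' hadm' (ho₁ ▸ hlt))⟩
      · refine hread b' ε' hadm' (hhead'.trans hhead₁) A' N' Θ' hpres' hWP' ?_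
        by_cases hin' : InPoly d A'
        · exact Or.inl (hM_conf d A₁ N₁ A' N' hctx hin₁ hin' hconf hfam)
        · exact Or.inr (Or.inr hin')
    · obtain ⟨Φ, w, hmv, hcl⟩ := hP2' b₁ ε₁ d A₁ N₁ Θ₁ hadm₁ ho₁' hc₁ hpres₁ hin₁ hconf
      refine ⟨Φ, w, hmv, hcl.mono fun b' hb' => ?_⟩
      obtain ⟨ε', hadm', hcase⟩ := hb'
      rcases hcase with hlt | ⟨hhead', A', N', Θ', hpres', hWP', hfam⟩
      · exact ⟨((b', ε'), (A₀, N₀)), rfl, Or.inl (hQ_of_lt b' ε' hadm' (ho₁ ▸ hlt))⟩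
      · refine hread b' ε' hadm' (hhead'.trans hhead₁) A' N' Θ' hpres' hWP' ?_
        by_cases hin' : InPoly d A'
        · have hM := hM_succ d A₁ N₁ A' N' hctx hin₁ hin' hfam
          have hrel : PolyRelSel d (ψsel d) A' A₁ := ⟨mem_succTSel_of_succFamilySel hfam, hin₁, hin'⟩
          have hrk : rk A' < rk A₁ := ((wellFounded_polyRelSel (k := k) hd (hsel d)).apply A₁).rank_lt_of_rel hrel
          rcases hM.lt_or_eq with hMlt | hMeq
          · exact Or.inl hMlt
          · exact Or.inr (Or.inl ⟨hMeq, hrk⟩)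
        · exact Or.inr (Or.inr hin')
  -- project through the unfold
  have hmap := hwin.map (germ := Prod.fst) (germ' := germ) (Q' := Q)
    (Q := fun τ : MvPowerSeries (Fin (2 + 1)) k × Decoration k 2 =>
      Admissible τ.1 τ.2 ∧ (τ.2.head < δ.head ∨ (τ.2.head = δ.head ∧ (τ.2.HCol ∨ τ.2.GoodDir ∨ τ.2.BadDir))))
    (fun σ : St => (σ.1.1, U σ.1.2)) (fun _ => rfl) (fun _ hq => hq)
  simpa only [hU0] using hmap

/-- **`stub_regimeLetter` FROM THE PIECES OF REGIME (P)**, under the stub's binders `∀ p prime, ∀ k, [Field k] [CharP k p] [IsAlgClosed k]`. -/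
theorem stub_regimeLetter_of_pieces
    (ψsel : ∀ (k : Type) [Field k] (d : ℕ), (Fin d → MvPowerSeries (Fin 2) k) → MvPowerSeries (Fin 2) k)
    (hsel : ∀ (p : ℕ), p.Prime → ∀ (k : Type) [Field k] [CharP k p] [IsAlgClosed k],
      ∀ (d : ℕ) (X : Fin d → MvPowerSeries (Fin 2) k), IsPosT d X → IsPrepRecentring d X (ψsel k d X))
    (M : ∀ (k : Type) [Field k] (d : ℕ), (Fin d → MvPowerSeries (Fin 2) k) → Finset (Fin 2) → ℕ)
    (hM_succ : ∀ (p : ℕ), p.Prime → ∀ (k : Type) [Field k] [CharP k p] [IsAlgClosed k],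
      ∀ (d : ℕ) (A : Fin d → MvPowerSeries (Fin 2) k) (N : Finset (Fin 2)) (A' : Fin d → MvPowerSeries (Fin 2) k) (N' : Finset (Fin 2)),
      (∃ (b : MvPowerSeries (Fin 3) k) (δ : Decoration k 2) (Θ : Fin 3 → MvPowerSeries (Fin 3) k),
        Admissible b δ ∧ 2 ≤ δ.o ∧ δ.c = d ∧ δ.PresBy d A N Θ) →
      InPoly d A → InPoly d A' → SuccFamilySel d (ψsel k d) A N A' N' → M k d A' N' ≤ M k d A N)
    (hM_conf : ∀ (p : ℕ), p.Prime → ∀ (k : Type) [Field k] [CharP k p] [IsAlgClosed k],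
      ∀ (d : ℕ) (A : Fin d → MvPowerSeries (Fin 2) k) (N : Finset (Fin 2)) (A' : Fin d → MvPowerSeries (Fin 2) k) (N' : Finset (Fin 2)),
      (∃ (b : MvPowerSeries (Fin 3) k) (δ : Decoration k 2) (Θ : Fin 3 → MvPowerSeries (Fin 3) k),
        Admissible b δ ∧ 2 ≤ δ.o ∧ δ.c = d ∧ δ.PresBy d A N Θ) →
      InPoly d A → InPoly d A' → NCPoly.Conflict d A N → PointFamilySel d (ψsel k d) A N A' N' → M k d A' N' < M k d A N)
    (hP1 : ∀ (p : ℕ), p.Prime → ∀ (k : Type) [Field k] [CharP k p] [IsAlgClosed k],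
      ∀ (b : MvPowerSeries (Fin 3) k) (δ : Decoration k 2), Admissible b δ → 2 ≤ δ.o → ¬ δ.HCol → (δ.O.Nonempty ∨ δ.GoodDir) →
      ∃ (A : Fin δ.c → MvPowerSeries (Fin 2) k) (N : Finset (Fin 2)) (Θ : Fin 3 → MvPowerSeries (Fin 3) k),
        δ.PresBy δ.c A N Θ ∧ InPoly δ.c A)
    (hPx : ∀ (p : ℕ), p.Prime → ∀ (k : Type) [Field k] [CharP k p] [IsAlgClosed k],
      ∀ (b : MvPowerSeries (Fin 3) k) (δ : Decoration k 2) (d : ℕ) (A : Fin d → MvPowerSeries (Fin 2) k) (N : Finset (Fin 2))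
      (Θ : Fin 3 → MvPowerSeries (Fin 3) k),
      Admissible b δ → 2 ≤ δ.o → δ.c = d → δ.PresBy d A N Θ → WellPrepared d A → ¬ InPoly d A → δ.HCol)
    (hP2' : ∀ (p : ℕ), p.Prime → ∀ (k : Type) [Field k] [CharP k p] [IsAlgClosed k],
      ∀ (b : MvPowerSeries (Fin 3) k) (δ : Decoration k 2) (d : ℕ) (A : Fin d → MvPowerSeries (Fin 2) k) (N : Finset (Fin 2))
      (Θ : Fin 3 → MvPowerSeries (Fin 3) k),
      Admissible b δ → 2 ≤ δ.o → δ.c = d → δ.PresBy d A N Θ → InPoly d A → ¬ NCPoly.Conflict d A N →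
      ∃ (Φ : Fin 3 → MvPowerSeries (Fin 3) k) (w : Fin 3 → ℕ), IsCountMove (m := 2) Φ w ∧
        MoveClause (m := 2) b Φ w (fun b' => ∃ δ' : Decoration k 2, Admissible b' δ' ∧ (δ'.o < δ.o ∨ (δ'.head = δ.head ∧
          ∃ (A' : Fin d → MvPowerSeries (Fin 2) k) (N' : Finset (Fin 2)) (Θ' : Fin 3 → MvPowerSeries (Fin 3) k),
            δ'.PresBy d A' N' Θ' ∧ WellPrepared d A' ∧ SuccFamilySel d (ψsel k d) A N A' N'))))
    (hP2c' : ∀ (p : ℕ), p.Prime → ∀ (k : Type) [Field k] [CharP k p] [IsAlgClosed k],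
      ∀ (b : MvPowerSeries (Fin 3) k) (δ : Decoration k 2) (d : ℕ) (A : Fin d → MvPowerSeries (Fin 2) k) (N : Finset (Fin 2))
      (Θ : Fin 3 → MvPowerSeries (Fin 3) k),
      Admissible b δ → 2 ≤ δ.o → δ.c = d → δ.PresBy d A N Θ → InPoly d A → NCPoly.Conflict d A N →
      ∃ (Φ : Fin 3 → MvPowerSeries (Fin 3) k) (w : Fin 3 → ℕ), IsCountMove (m := 2) Φ w ∧
        MoveClause (m := 2) b Φ w (fun b' => ∃ δ' : Decoration k 2, Admissible b' δ' ∧ (δ'.o < δ.o ∨ (δ'.head = δ.head ∧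
          ∃ (A' : Fin d → MvPowerSeries (Fin 2) k) (N' : Finset (Fin 2)) (Θ' : Fin 3 → MvPowerSeries (Fin 3) k),
            δ'.PresBy d A' N' Θ' ∧ WellPrepared d A' ∧ PointFamilySel d (ψsel k d) A N A' N')))) :
    ∀ (p : ℕ), p.Prime → ∀ (k : Type) [Field k] [CharP k p] [IsAlgClosed k],
      ∀ (b : MvPowerSeries (Fin 3) k) (δ : Decoration k 2) (l : Fin 3), Admissible b δ → 2 ≤ δ.o → ¬ δ.HCol → δ.LetterDir l →
        DWinsTo (St := MvPowerSeries (Fin 3) k × Decoration k 2) Prod.fst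
          (fun τ => Admissible τ.1 τ.2 ∧ (τ.2.head < δ.head ∨ (τ.2.head = δ.head ∧ (τ.2.HCol ∨ τ.2.GoodDir ∨ τ.2.BadDir)))) (b, δ) :=
  fun p hp k _ _ _ b δ _ hadm ho _ hl =>
    regimeLetter_of_pieces (ψsel k) (hsel p hp k) (M k) (hM_succ p hp k) (hM_conf p hp k) (hP1 p hp k) (hPx p hp k) (hP2' p hp k)
      (hP2c' p hp k) b δ hadm ho hl

/-! ## The v2 step shapes imply the v1 shapes of regime (P) -/

/-- **REGIME (P) FROM ITS PIECES, v2 step shapes** (the same head always hands over the presented successor). -/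
theorem regimePresented_of_pieces₂ [Infinite k]
    (ψsel : (d : ℕ) → (Fin d → MvPowerSeries (Fin 2) k) → MvPowerSeries (Fin 2) k)
    (hsel : ∀ (d : ℕ) (X : Fin d → MvPowerSeries (Fin 2) k), IsPosT d X → IsPrepRecentring d X (ψsel d X))
    (M : (d : ℕ) → (Fin d → MvPowerSeries (Fin 2) k) → Finset (Fin 2) → ℕ)
    (hM_succ : ∀ (d : ℕ) (A : Fin d → MvPowerSeries (Fin 2) k) (N : Finset (Fin 2)) (A' : Fin d → MvPowerSeries (Fin 2) k)
      (N' : Finset (Fin 2)),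
      (∃ (b : MvPowerSeries (Fin (2 + 1)) k) (δ : Decoration k 2) (Θ : Fin (2 + 1) → MvPowerSeries (Fin (2 + 1)) k),
        Admissible b δ ∧ 2 ≤ δ.o ∧ δ.c = d ∧ δ.PresBy d A N Θ) →
      InPoly d A → InPoly d A' → SuccFamilySel d (ψsel d) A N A' N' → M d A' N' ≤ M d A N)
    (hM_conf : ∀ (d : ℕ) (A : Fin d → MvPowerSeries (Fin 2) k) (N : Finset (Fin 2)) (A' : Fin d → MvPowerSeries (Fin 2) k)
      (N' : Finset (Fin 2)),
      (∃ (b : MvPowerSeries (Fin (2 + 1)) k) (δ : Decoration k 2) (Θ : Fin (2 + 1) → MvPowerSeries (Fin (2 + 1)) k),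
        Admissible b δ ∧ 2 ≤ δ.o ∧ δ.c = d ∧ δ.PresBy d A N Θ) →
      InPoly d A → InPoly d A' → NCPoly.Conflict d A N → PointFamilySel d (ψsel d) A N A' N' → M d A' N' < M d A N)
    (hP1 : ∀ (b : MvPowerSeries (Fin (2 + 1)) k) (δ : Decoration k 2), Admissible b δ → 2 ≤ δ.o → ¬ δ.HCol →
      (δ.O.Nonempty ∨ δ.GoodDir) →
      ∃ (A : Fin δ.c → MvPowerSeries (Fin 2) k) (N : Finset (Fin 2)) (Θ : Fin (2 + 1) → MvPowerSeries (Fin (2 + 1)) k),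
        δ.PresBy δ.c A N Θ ∧ InPoly δ.c A)
    (hPx : ∀ (b : MvPowerSeries (Fin (2 + 1)) k) (δ : Decoration k 2) (d : ℕ) (A : Fin d → MvPowerSeries (Fin 2) k) (N : Finset (Fin 2))
      (Θ : Fin (2 + 1) → MvPowerSeries (Fin (2 + 1)) k),
      Admissible b δ → 2 ≤ δ.o → δ.c = d → δ.PresBy d A N Θ → WellPrepared d A → ¬ InPoly d A → δ.HCol)
    (hP2' : ∀ (b : MvPowerSeries (Fin (2 + 1)) k) (δ : Decoration k 2) (d : ℕ) (A : Fin d → MvPowerSeries (Fin 2) k) (N : Finset (Fin 2))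
      (Θ : Fin (2 + 1) → MvPowerSeries (Fin (2 + 1)) k),
      Admissible b δ → 2 ≤ δ.o → δ.c = d → δ.PresBy d A N Θ → InPoly d A → ¬ NCPoly.Conflict d A N →
      ∃ (Φ : Fin (2 + 1) → MvPowerSeries (Fin (2 + 1)) k) (w : Fin (2 + 1) → ℕ), IsCountMove Φ w ∧
        MoveClause b Φ w (fun b' => ∃ δ' : Decoration k 2, Admissible b' δ' ∧ (δ'.o < δ.o ∨ (δ'.head = δ.head ∧
          ∃ (A' : Fin d → MvPowerSeries (Fin 2) k) (N' : Finset (Fin 2)) (Θ' : Fin (2 + 1) → MvPowerSeries (Fin (2 + 1)) k),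
            δ'.PresBy d A' N' Θ' ∧ WellPrepared d A' ∧ SuccFamilySel d (ψsel d) A N A' N'))))
    (hP2c' : ∀ (b : MvPowerSeries (Fin (2 + 1)) k) (δ : Decoration k 2) (d : ℕ) (A : Fin d → MvPowerSeries (Fin 2) k) (N : Finset (Fin 2))
      (Θ : Fin (2 + 1) → MvPowerSeries (Fin (2 + 1)) k),
      Admissible b δ → 2 ≤ δ.o → δ.c = d → δ.PresBy d A N Θ → InPoly d A → NCPoly.Conflict d A N →
      ∃ (Φ : Fin (2 + 1) → MvPowerSeries (Fin (2 + 1)) k) (w : Fin (2 + 1) → ℕ), IsCountMove Φ w ∧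
        MoveClause b Φ w (fun b' => ∃ δ' : Decoration k 2, Admissible b' δ' ∧ (δ'.o < δ.o ∨ (δ'.head = δ.head ∧
          ∃ (A' : Fin d → MvPowerSeries (Fin 2) k) (N' : Finset (Fin 2)) (Θ' : Fin (2 + 1) → MvPowerSeries (Fin (2 + 1)) k),
            δ'.PresBy d A' N' Θ' ∧ WellPrepared d A' ∧ PointFamilySel d (ψsel d) A N A' N'))))
    (b : MvPowerSeries (Fin (2 + 1)) k) (δ : Decoration k 2) (hadm : Admissible b δ) (ho : 2 ≤ δ.o) (hnc : ¬ δ.HCol)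
    (hreg : δ.O.Nonempty ∨ δ.GoodDir) :
    DWinsTo (St := MvPowerSeries (Fin (2 + 1)) k × Decoration k 2) Prod.fst
      (fun τ => Admissible τ.1 τ.2 ∧ (τ.2.head < δ.head ∨ (τ.2.head = δ.head ∧ τ.2.HCol))) (b, δ) := by
  have hlt : ∀ δ δ' : Decoration k 2, δ'.o < δ.o → δ'.head < δ.head := fun δ δ' h => by
    rw [Decoration.head, Decoration.head, Prod.Lex.toLex_lt_toLex]; exact Or.inl h
  refine regimePresented_of_pieces ψsel hsel M hM_succ hM_conf hP1 hPx (fun b δ d A N Θ hadm ho hc hpres hin hconf => ?_)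
    (fun b δ d A N Θ hadm ho hc hpres hin hconf => ?_) b δ hadm ho hnc hreg
  · obtain ⟨Φ, w, hmv, hcl⟩ := hP2' b δ d A N Θ hadm ho hc hpres hin hconf
    refine ⟨Φ, w, hmv, hcl.mono fun b' ⟨δ', hadm', hcase⟩ => ⟨δ', hadm', ?_⟩⟩
    exact hcase.imp (hlt δ δ') fun h => ⟨h.1, Or.inr h.2⟩
  · obtain ⟨Φ, w, hmv, hcl⟩ := hP2c' b δ d A N Θ hadm ho hc hpres hin hconf
    refine ⟨Φ, w, hmv, hcl.mono fun b' ⟨δ', hadm', hcase⟩ => ⟨δ', hadm', ?_⟩⟩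
    exact hcase.imp (hlt δ δ') fun h => ⟨h.1, Or.inr h.2⟩

end TameFourTupleDrop

end Summit.ResolutionOfSingularities.ResolutionOfSingularities.Theorems

end
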